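import Mathlib
import Summits.Ventures.PercRepro2.CoinChainXACross
import Summits.Ventures.PercRepro2.CoinKSureAD

/-!
# (XA′) as a STOCHASTIC DOMINATION — the Ω-law of the general AND-switch chain
(blind cell PercRepro2, night-2 g27; proofs/NIGHT2-DARC.md §68)

For the general AND-switch chain (`R⁰ = ν·chainMix ent ent' 0 c d`, `R¹`, `G⁰`, `G¹` the four chain
laws, `Q = R⁰ − R¹` the coin-killed law, `P⁰ = R⁰ − G⁰` the world-0 pivotal law,
`P′ = (R¹ − G¹) − P⁰` the `D′`-pivotal law) the coin-free inequality (XA′) `a0·U001 ≥ Cross` of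
`chain_functional_nonneg_of_XA'` is, for EVERY marker `y`, the statement that the nonnegative law
  `Ω̂ := a0²·G¹·y + a0·a2·P′ + (a0·e2 + a2·(a0 − e0))·Q + (a0·b2 + a2·(a0 − b0))·P⁰`
has `x`-mean at least the `R⁰`-mean of `x`:
  `a0·U001 − Cross = ∑_W Ω̂(W)·(a0·x(W) − a1)`   (`xa_omega_identity`, a ring identity).
Hence (XA′) for all increasing `x` is EXACTLY the stochastic domination `Ω̂/|Ω̂| ≽ R⁰/a0` — a
degree-2 statement in the laws; `chain_XA'_of_omega_holley` gives (XA′) whenever `Ω̂` is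
Holley-above `R⁰` (`ad_pointwise`), `chain_omega_nonneg` the pointwise nonnegativity of `Ω̂`.
-/

namespace Summit.Ventures.PercRepro2.Coin

open Classical

section OmegaAbstract

variable {V : Type*} [DecidableEq V] {R : Type*} [CommRing R]

omit [DecidableEq V] in
/-- **THE Ω-IDENTITY** (pure algebra, any laws `R0 R1 G0 G1` and markers `x y`): with the moments
`a = R0`, `b = R1`, `e = G0`, `g = G1` (`a0 = ∑ R0`, `a1 = ∑ R0 x`, `a2 = ∑ R0 y`, …),
`a0·U001 − Cross = ∑_W Ω̂(W)·(a0·x W − a1)` where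
`Ω̂ W = a0²·G1 W·y W + a0·a2·(R1 W − G1 W − R0 W + G0 W) + (a0 e2 + a2 (a0 − e0))·(R0 W − R1 W)
        + (a0 b2 + a2 (a0 − b0))·(R0 W − G0 W)`. -/
theorem xa_omega_identity (U : Finset V) (R0 R1 G0 G1 x y : Finset V → R)
    (a0 a1 a2 b0 b1 b2 e0 e1 e2 g0 g1 g2 g12 : R)
    (ha0 : a0 = ∑ W ∈ U.powerset, R0 W) (ha1 : a1 = ∑ W ∈ U.powerset, R0 W * x W)
    (ha2 : a2 = ∑ W ∈ U.powerset, R0 W * y W)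
    (hb0 : b0 = ∑ W ∈ U.powerset, R1 W) (hb1 : b1 = ∑ W ∈ U.powerset, R1 W * x W)
    (hb2 : b2 = ∑ W ∈ U.powerset, R1 W * y W)
    (he0 : e0 = ∑ W ∈ U.powerset, G0 W) (he1 : e1 = ∑ W ∈ U.powerset, G0 W * x W)
    (he2 : e2 = ∑ W ∈ U.powerset, G0 W * y W)
    (hg0 : g0 = ∑ W ∈ U.powerset, G1 W) (hg1 : g1 = ∑ W ∈ U.powerset, G1 W * x W)
    (hg2 : g2 = ∑ W ∈ U.powerset, G1 W * y W)
    (hg12 : g12 = ∑ W ∈ U.powerset, G1 W * (x W * y W)) :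
    a0 * (a0 * a0 * g12 - a0 * a2 * g1 - a0 * a1 * g2 + a1 * a2 * g0)
      - ((a0 * b1 - a1 * b0) * (a0 * e2 - a2 * e0) + (a0 * b2 - a2 * b0) * (a0 * e1 - a1 * e0))
    = ∑ W ∈ U.powerset,
        (a0 ^ 2 * G1 W * y W + a0 * a2 * (R1 W - G1 W - R0 W + G0 W)
          + (a0 * e2 + a2 * (a0 - e0)) * (R0 W - R1 W)
          + (a0 * b2 + a2 * (a0 - b0)) * (R0 W - G0 W)) * (a0 * x W - a1) := by
  have key : ∀ W, (a0 ^ 2 * G1 W * y W + a0 * a2 * (R1 W - G1 W - R0 W + G0 W)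
      + (a0 * e2 + a2 * (a0 - e0)) * (R0 W - R1 W)
      + (a0 * b2 + a2 * (a0 - b0)) * (R0 W - G0 W)) * (a0 * x W - a1)
      = a0 ^ 3 * (G1 W * (x W * y W)) - a0 ^ 2 * a1 * (G1 W * y W)
        + a0 ^ 2 * a2 * (R1 W * x W) - a0 * a1 * a2 * R1 W
        - a0 ^ 2 * a2 * (G1 W * x W) + a0 * a1 * a2 * G1 W
        - a0 ^ 2 * a2 * (R0 W * x W) + a0 * a1 * a2 * R0 W
        + a0 ^ 2 * a2 * (G0 W * x W) - a0 * a1 * a2 * G0 W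
        + ((a0 * e2 + a2 * (a0 - e0)) * a0) * (R0 W * x W) - ((a0 * e2 + a2 * (a0 - e0)) * a1) * R0 W
        - ((a0 * e2 + a2 * (a0 - e0)) * a0) * (R1 W * x W) + ((a0 * e2 + a2 * (a0 - e0)) * a1) * R1 W
        + ((a0 * b2 + a2 * (a0 - b0)) * a0) * (R0 W * x W) - ((a0 * b2 + a2 * (a0 - b0)) * a1) * R0 W
        - ((a0 * b2 + a2 * (a0 - b0)) * a0) * (G0 W * x W) + ((a0 * b2 + a2 * (a0 - b0)) * a1) * G0 W := by
    intro W; ring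
  subst ha0 ha1 ha2 hb0 hb1 hb2 he0 he1 he2 hg0 hg1 hg2 hg12
  simp only [key, Finset.sum_add_distrib, Finset.sum_sub_distrib, ← Finset.mul_sum]
  ring

end OmegaAbstract

section OmegaChain

variable {V : Type*} [DecidableEq V] {R : Type*} [Field R] [LinearOrder R] [IsStrictOrderedRing R]

/-- **THE Ω-LAW OF THE CHAIN IS NONNEGATIVE** (pointwise): with `R⁰ = ν·chainMix 0 c d`,
`R¹ = ν·chainMix 1 c d`, `G⁰ = ν·chainMix 0 c d'`, `G¹ = ν·chainMix 1 c d'` and the moments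
`a0 = ∑ R⁰`, `a2 = ∑ R⁰ y`, `b0 = ∑ R¹`, `b2 = ∑ R¹ y`, `e0 = ∑ G⁰`, `e2 = ∑ G⁰ y`, for every `W`
`Ω̂ W = a0²·G¹ W·y W + a0·a2·P′ W + (a0 e2 + a2 (a0 − e0))·Q W + (a0 b2 + a2 (a0 − b0))·P⁰ W ≥ 0`
(`Q = R⁰ − R¹`, `P⁰ = R⁰ − G⁰`, `P′ = R¹ − G¹ − P⁰`; needs `d ≤ c`, `d' ≤ d`, `y ≥ 0`). -/
theorem chain_omega_nonneg (U ent ent' : Finset V) (ν c d d' : Finset V → R)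
    (hν0 : ∀ W, 0 ≤ ν W) (hc0 : ∀ W, 0 ≤ c W) (hd0 : ∀ W, 0 ≤ d W) (hd'0 : ∀ W, 0 ≤ d' W)
    (hdc : ∀ W, d W ≤ c W) (hd'd : ∀ W, d' W ≤ d W) (y : Finset V → R) (hy0 : ∀ W, 0 ≤ y W)
    (W : Finset V) :
    0 ≤ (∑ W ∈ U.powerset, ν W * chainMix ent ent' 0 c d W) ^ 2 * (ν W * chainMix ent ent' 1 c d' W) * y W
        + (∑ W ∈ U.powerset, ν W * chainMix ent ent' 0 c d W) * (∑ W ∈ U.powerset, ν W * chainMix ent ent' 0 c d W * y W)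
          * (ν W * chainMix ent ent' 1 c d W - ν W * chainMix ent ent' 1 c d' W - ν W * chainMix ent ent' 0 c d W + ν W * chainMix ent ent' 0 c d' W)
        + ((∑ W ∈ U.powerset, ν W * chainMix ent ent' 0 c d W) * (∑ W ∈ U.powerset, ν W * chainMix ent ent' 0 c d' W * y W)
            + (∑ W ∈ U.powerset, ν W * chainMix ent ent' 0 c d W * y W) * ((∑ W ∈ U.powerset, ν W * chainMix ent ent' 0 c d W) - (∑ W ∈ U.powerset, ν W * chainMix ent ent' 0 c d' W)))
          * (ν W * chainMix ent ent' 0 c d W - ν W * chainMix ent ent' 1 c d W)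
        + ((∑ W ∈ U.powerset, ν W * chainMix ent ent' 0 c d W) * (∑ W ∈ U.powerset, ν W * chainMix ent ent' 1 c d W * y W)
            + (∑ W ∈ U.powerset, ν W * chainMix ent ent' 0 c d W * y W) * ((∑ W ∈ U.powerset, ν W * chainMix ent ent' 0 c d W) - (∑ W ∈ U.powerset, ν W * chainMix ent ent' 1 c d W)))
          * (ν W * chainMix ent ent' 0 c d W - ν W * chainMix ent ent' 0 c d' W) := by
  have hmix0 : ∀ W, 0 ≤ chainMix ent ent' 0 c d W :=
    fun W => chainMix_nonneg ent ent' le_rfl zero_le_one hc0 hd0 W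
  have hmix0' : ∀ W, 0 ≤ chainMix ent ent' 0 c d' W :=
    fun W => chainMix_nonneg ent ent' le_rfl zero_le_one hc0 hd'0 W
  have hmix1 : ∀ W, 0 ≤ chainMix ent ent' 1 c d W :=
    fun W => chainMix_nonneg ent ent' zero_le_one le_rfl hc0 hd0 W
  have hmix1' : ∀ W, 0 ≤ chainMix ent ent' 1 c d' W :=
    fun W => chainMix_nonneg ent ent' zero_le_one le_rfl hc0 hd'0 W
  have ha0 : 0 ≤ ∑ W ∈ U.powerset, ν W * chainMix ent ent' 0 c d W :=
    Finset.sum_nonneg fun W _ => mul_nonneg (hν0 W) (hmix0 W)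
  have ha2 : 0 ≤ ∑ W ∈ U.powerset, ν W * chainMix ent ent' 0 c d W * y W :=
    Finset.sum_nonneg fun W _ => mul_nonneg (mul_nonneg (hν0 W) (hmix0 W)) (hy0 W)
  have he2 : 0 ≤ ∑ W ∈ U.powerset, ν W * chainMix ent ent' 0 c d' W * y W :=
    Finset.sum_nonneg fun W _ => mul_nonneg (mul_nonneg (hν0 W) (hmix0' W)) (hy0 W)
  have hb2 : 0 ≤ ∑ W ∈ U.powerset, ν W * chainMix ent ent' 1 c d W * y W :=
    Finset.sum_nonneg fun W _ => mul_nonneg (mul_nonneg (hν0 W) (hmix1 W)) (hy0 W)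
  have he0a : ∑ W ∈ U.powerset, ν W * chainMix ent ent' 0 c d' W ≤ ∑ W ∈ U.powerset, ν W * chainMix ent ent' 0 c d W :=
    Finset.sum_le_sum fun W _ => mul_le_mul_of_nonneg_left (chainMix_le_of_le ent ent' le_rfl zero_le_one hd'd W) (hν0 W)
  have hb0a : ∑ W ∈ U.powerset, ν W * chainMix ent ent' 1 c d W ≤ ∑ W ∈ U.powerset, ν W * chainMix ent ent' 0 c d W :=
    Finset.sum_le_sum fun W _ => mul_le_mul_of_nonneg_left (chainMix_one_le_zero ent ent' hdc W) (hν0 W)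
  have hP' : 0 ≤ ν W * chainMix ent ent' 1 c d W - ν W * chainMix ent ent' 1 c d' W - ν W * chainMix ent ent' 0 c d W + ν W * chainMix ent ent' 0 c d' W := by
    have := chainMix_sub_zero_le_one ent ent' (c := c) hd'd W
    nlinarith [hν0 W]
  have hQ : 0 ≤ ν W * chainMix ent ent' 0 c d W - ν W * chainMix ent ent' 1 c d W := by
    have := chainMix_one_le_zero ent ent' (c := c) (d := d) hdc W
    nlinarith [hν0 W]
  have hP0 : 0 ≤ ν W * chainMix ent ent' 0 c d W - ν W * chainMix ent ent' 0 c d' W := by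
    have := chainMix_le_of_le ent ent' le_rfl zero_le_one (c := c) hd'd W
    nlinarith [hν0 W]
  have hG1 : 0 ≤ ν W * chainMix ent ent' 1 c d' W := mul_nonneg (hν0 W) (hmix1' W)
  refine add_nonneg (add_nonneg (add_nonneg ?_ ?_) ?_) ?_
  · exact mul_nonneg (mul_nonneg (pow_nonneg ha0 2) hG1) (hy0 W)
  · exact mul_nonneg (mul_nonneg ha0 ha2) hP'
  · refine mul_nonneg (add_nonneg (mul_nonneg ha0 he2) (mul_nonneg ha2 ?_)) hQ
    linarith
  · refine mul_nonneg (add_nonneg (mul_nonneg ha0 hb2) (mul_nonneg ha2 ?_)) hP0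
    linarith


/-- **THE GENERAL AND-SWITCH CHAIN FROM THE Ω-CONDITION.** If the Ω-law of the chain (the law
`Ω̂` of `chain_omega_nonneg`) has `x`-mean at least the `R⁰`-mean of `x` — in cleared form
`0 ≤ ∑ Ω̂ W · (a0·x W − a1)` — then (XA′) holds (`xa_omega_identity`), hence the chain functional
is nonnegative at every `ρ ∈ [0, 1]` (`chain_functional_nonneg_of_XA'`). -/
theorem chain_functional_nonneg_of_omega (U ent ent' : Finset V) (ν c d d' : Finset V → R)
    (ρ : R) (hρ0 : 0 ≤ ρ) (hρ1 : ρ ≤ 1) (hν0 : ∀ W, 0 ≤ ν W)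
    (hν : ∀ s ⊆ U, ∀ t ⊆ U, ν s * ν t ≤ ν (s ∩ t) * ν (s ∪ t))
    (hc0 : ∀ W, 0 ≤ c W) (hd0 : ∀ W, 0 ≤ d W) (hd'0 : ∀ W, 0 ≤ d' W)
    (hdc : ∀ W, d W ≤ c W) (hd'c : ∀ W, d' W ≤ c W) (hd'd : ∀ W, d' W ≤ d W)
    (hcc : ∀ s t, c s * c t ≤ c (s ∩ t) * c (s ∪ t))
    (hdd : ∀ s t, d s * d t ≤ d (s ∩ t) * d (s ∪ t))
    (hd'd' : ∀ s t, d' s * d' t ≤ d' (s ∩ t) * d' (s ∪ t))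
    (hcd : ∀ s t, c s * d t ≤ c (s ∩ t) * d (s ∪ t))
    (hcd' : ∀ s t, c s * d' t ≤ c (s ∩ t) * d' (s ∪ t))
    (hdd' : ∀ s t, d s * d' t ≤ d (s ∩ t) * d' (s ∪ t))
    (hratio : ∀ s t, s ⊆ t → d s * c t ≤ c s * d t)
    (hratio' : ∀ s t, s ⊆ t → d' s * c t ≤ c s * d' t)
    (x y : Finset V → R) (hx0 : ∀ W, 0 ≤ x W) (hy0 : ∀ W, 0 ≤ y W)
    (hxm : ∀ s t, x s ≤ x (s ∪ t)) (hym : ∀ s t, y s ≤ y (s ∪ t))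
    (hpos0 : 0 < ∑ W ∈ U.powerset, ν W * chainMix ent ent' 0 c d W)
    (hpos1 : 0 < ∑ W ∈ U.powerset, ν W * chainMix ent ent' 1 c d W)
    (hmI : 0 < ∑ W ∈ U.powerset.filter (fun W => ¬ ∃ r ∈ ent ∪ ent', r ∈ W), ν W * c W)
    (hΩ : 0 ≤ ∑ W ∈ U.powerset,
        ((∑ W ∈ U.powerset, ν W * chainMix ent ent' 0 c d W) ^ 2 * (ν W * chainMix ent ent' 1 c d' W) * y W
          + (∑ W ∈ U.powerset, ν W * chainMix ent ent' 0 c d W) * (∑ W ∈ U.powerset, ν W * chainMix ent ent' 0 c d W * y W)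
            * (ν W * chainMix ent ent' 1 c d W - ν W * chainMix ent ent' 1 c d' W - ν W * chainMix ent ent' 0 c d W + ν W * chainMix ent ent' 0 c d' W)
          + ((∑ W ∈ U.powerset, ν W * chainMix ent ent' 0 c d W) * (∑ W ∈ U.powerset, ν W * chainMix ent ent' 0 c d' W * y W)
              + (∑ W ∈ U.powerset, ν W * chainMix ent ent' 0 c d W * y W) * ((∑ W ∈ U.powerset, ν W * chainMix ent ent' 0 c d W) - (∑ W ∈ U.powerset, ν W * chainMix ent ent' 0 c d' W)))
            * (ν W * chainMix ent ent' 0 c d W - ν W * chainMix ent ent' 1 c d W)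
          + ((∑ W ∈ U.powerset, ν W * chainMix ent ent' 0 c d W) * (∑ W ∈ U.powerset, ν W * chainMix ent ent' 1 c d W * y W)
              + (∑ W ∈ U.powerset, ν W * chainMix ent ent' 0 c d W * y W) * ((∑ W ∈ U.powerset, ν W * chainMix ent ent' 0 c d W) - (∑ W ∈ U.powerset, ν W * chainMix ent ent' 1 c d W)))
            * (ν W * chainMix ent ent' 0 c d W - ν W * chainMix ent ent' 0 c d' W))
        * ((∑ W ∈ U.powerset, ν W * chainMix ent ent' 0 c d W) * x W - (∑ W ∈ U.powerset, ν W * chainMix ent ent' 0 c d W * x W))) :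
    0 ≤ (∑ W ∈ U.powerset, ν W * chainMix ent ent' ρ c d W) ^ 2 *
          (∑ W ∈ U.powerset, ν W * chainMix ent ent' ρ c d' W * (x W * y W))
        - (∑ W ∈ U.powerset, ν W * chainMix ent ent' ρ c d W) *
          (∑ W ∈ U.powerset, ν W * chainMix ent ent' ρ c d W * x W) *
          (∑ W ∈ U.powerset, ν W * chainMix ent ent' ρ c d' W * y W)
        - (∑ W ∈ U.powerset, ν W * chainMix ent ent' ρ c d W) *
          (∑ W ∈ U.powerset, ν W * chainMix ent ent' ρ c d W * y W) *
          (∑ W ∈ U.powerset, ν W * chainMix ent ent' ρ c d' W * x W)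
        + (∑ W ∈ U.powerset, ν W * chainMix ent ent' ρ c d W * x W) *
          (∑ W ∈ U.powerset, ν W * chainMix ent ent' ρ c d W * y W) *
          (∑ W ∈ U.powerset, ν W * chainMix ent ent' ρ c d' W) := by
  have hid := xa_omega_identity U (fun W => ν W * chainMix ent ent' 0 c d W)
    (fun W => ν W * chainMix ent ent' 1 c d W) (fun W => ν W * chainMix ent ent' 0 c d' W)
    (fun W => ν W * chainMix ent ent' 1 c d' W) x y _ _ _ _ _ _ _ _ _ _ _ _ _
    rfl rfl rfl rfl rfl rfl rfl rfl rfl rfl rfl rfl rfl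
  refine chain_functional_nonneg_of_XA' U ent ent' ν c d d' ρ hρ0 hρ1 hν0 hν hc0 hd0 hd'0 hdc
    hd'c hd'd hcc hdd hd'd' hcd hcd' hdd' hratio hratio' x y hx0 hy0 hxm hym hpos0 hpos1 hmI ?_
  linarith [hid, hΩ]


/-- **THE Ω-CONDITION FROM HOLLEY.** If a nonnegative law `Ω` is Holley-above the nonnegative law
`R0` on `U.powerset` (`Ω s · R0 t ≤ R0 (s ∩ t) · Ω (s ∪ t)`), then for every nonnegative increasing
`x` the `Ω`-mean of `x` is at least the `R0`-mean: `0 ≤ ∑ Ω W · ((∑ R0)·x W − ∑ R0 x)`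
(`ad_pointwise` with `F₁ = Ω`, `F₂ = R0·x`, `F₃ = R0`, `F₄ = Ω·x`). -/
theorem omega_cond_of_holley (U : Finset V) (Ω R0 x : Finset V → R)
    (hΩ0 : ∀ W, 0 ≤ Ω W) (hR0 : ∀ W, 0 ≤ R0 W) (hx0 : ∀ W, 0 ≤ x W)
    (hxm : ∀ s t, x s ≤ x (s ∪ t))
    (hHol : ∀ s ⊆ U, ∀ t ⊆ U, Ω s * R0 t ≤ R0 (s ∩ t) * Ω (s ∪ t)) :
    0 ≤ ∑ W ∈ U.powerset, Ω W * ((∑ W ∈ U.powerset, R0 W) * x W - ∑ W ∈ U.powerset, R0 W * x W) := by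
  have had := ad_pointwise U Ω (fun W => R0 W * x W) R0 (fun W => Ω W * x W) hΩ0
    (fun W => mul_nonneg (hR0 W) (hx0 W)) hR0 (fun W => mul_nonneg (hΩ0 W) (hx0 W)) ?_
  · have hterm : ∀ W, Ω W * ((∑ W ∈ U.powerset, R0 W) * x W - ∑ W ∈ U.powerset, R0 W * x W)
        = (∑ W ∈ U.powerset, R0 W) * (Ω W * x W) - (∑ W ∈ U.powerset, R0 W * x W) * Ω W := by
      intro W; ring
    simp only [hterm, Finset.sum_sub_distrib, ← Finset.mul_sum]
    linarith [had]
  · intro s hs t ht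
    have hxt : x t ≤ x (s ∪ t) := by rw [Finset.union_comm]; exact hxm t s
    calc Ω s * (R0 t * x t) = (Ω s * R0 t) * x t := by ring
      _ ≤ (R0 (s ∩ t) * Ω (s ∪ t)) * x (s ∪ t) :=
          mul_le_mul (hHol s hs t ht) hxt (hx0 t) (mul_nonneg (hR0 _) (hΩ0 _))
      _ = R0 (s ∩ t) * (Ω (s ∪ t) * x (s ∪ t)) := by ring

end OmegaChain

end Summit.Ventures.PercRepro2.Coin
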